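import Mathlib.Analysis.Calculus.BumpFunction.Convolution
import Mathlib.Analysis.Calculus.BumpFunction.FiniteDimension
import Mathlib.Analysis.Calculus.ContDiff.Deriv
import Mathlib.MeasureTheory.Integral.IntervalIntegral.FundThmCalculus
import Mathlib.MeasureTheory.Integral.DominatedConvergence
import HarnessLib

/-!
# A du Bois-Reymond lemma with initial datum: `∫ (η' U + η F) + η(0) c = 0` for all tests forces `U(t) = c + ∫₀ᵗ F`

Analysis/FunctionSpaces support file (serves the discharge of the Serrin–Prodi weak–strong
uniqueness theorem `Literature.Analysis.FluidPDE.weak_strong_uniqueness`: it is the one-dimensional core of the passage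
from the space–time weak formulation of the Navier–Stokes equations, tested with `η(t)Ψ(x)`, to the
time-sliced identity `⟨u(t),Ψ⟩ = ⟨u₀,Ψ⟩ + ∫₀ᵗ (…)` for every `t`; Serrin 1963, §3; Galdi 2000,
Lemma 2.1).

**Statement** (`Literature.Analysis.FunctionSpaces.eq_add_setIntegral_of_forall_test`). Let `U, F` be integrable on `(0,T)`, `U`
continuous on `(0,T)`, `c ∈ ℝ`, and suppose that for every smooth compactly supported
`η : ℝ → ℝ` with `tsupport η ⊆ (-∞, T)`
`∫_{(0,T)} (η' U + η F) + η(0) c = 0`.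
Then `U(t) = c + ∫_{(0,t]} F` for every `t ∈ (0,T)`.

This is the classical fact that a distributional identity `U' = F` on `(0,T)` with the boundary
term `η(0)c` identifies the continuous representative and its initial value (cf. H. Brezis,
*Functional Analysis*, Thm. 8.2; the boundary version is folklore in the Navier–Stokes literature,
e.g. Galdi 2000, Lemma 2.1). Proof: for `t ∈ (0,T)` and `ε ↓ 0` test with
`η_ε(s) = B(s)(1 - ∫_t^s ρ_ε)`, where `ρ_ε` is a normalised bump supported in `(t, t+ε)` and `B` a
bump equal to `1` on `[-1, T+1]`: then `η_ε(0) = 1`, `η_ε' = -ρ_ε` on `(0,T)`, so the identity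
reads `(ρ_ε ⋆ U)(t + ε/2) = c + ∫ η_ε F`; the left side tends to `U(t)` (continuity of `U` at `t`,
Mathlib's `ContDiffBump.convolution_tendsto_right`) and the right side to `c + ∫_{(0,t]} F`
(dominated convergence, `η_ε → 𝟙_{(-∞,t]}` boundedly).

## Mathlib search

Mathlib (this pin) has the fundamental lemma of the calculus of variations
(`IsOpen.ae_eq_zero_of_integral_contDiff_smul_eq_zero`) but no du Bois-Reymond lemma
(`∫ φ' f = 0 ⇒ f` constant) nor absolutely continuous representatives of `W^{1,1}` functions on an
interval (searched `du Bois`, `ae_eq_const_of`, `integral_deriv` in `MeasureTheory/`, `Analysis/`).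

## References

* J. Serrin, *The initial value problem for the Navier–Stokes equations*, in: Nonlinear Problems
  (Madison 1962), Univ. Wisconsin Press 1963, §3.
* G. P. Galdi, *An introduction to the Navier–Stokes initial-boundary value problem*, in:
  Fundamental Directions in Mathematical Fluid Mechanics, Birkhäuser 2000, Lemma 2.1.
* H. Brezis, *Functional Analysis, Sobolev Spaces and PDE* (Springer 2011), Lemma 8.1, Thm. 8.2.
-/

noncomputable section

open MeasureTheory TopologicalSpace Set Function Filter Topology Metric intervalIntegral
  ContinuousLinearMap
open scoped ENNReal NNReal Convolution ContDiff

namespace Literature.Analysis.FunctionSpaces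

/-! ### The primitive cutoff `1 - ∫_t^s ρ` of a bump `ρ` supported in `(t, t + ε)` -/

section Cutoff

variable {t : ℝ}

/-- The reflected shifted normalised bump `ρ(s) = φ.normed (t' - s)` is smooth. [folklore] -/
theorem contDiff_normed_comp_sub (φ : ContDiffBump (0 : ℝ)) (t' : ℝ) :
    ContDiff ℝ ∞ fun s => φ.normed volume (t' - s) :=
  φ.contDiff_normed.comp (contDiff_const.sub contDiff_id)

/-- Off the interval `(t' - rOut, t' + rOut)` the reflected shifted bump vanishes. [folklore] -/
theorem normed_comp_sub_eq_zero (φ : ContDiffBump (0 : ℝ)) {t' s : ℝ}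
    (hs : φ.rOut ≤ |t' - s|) : φ.normed volume (t' - s) = 0 := by
  have : t' - s ∉ Function.support (φ.normed volume) := by
    rw [φ.support_normed_eq]
    simpa [Real.norm_eq_abs] using hs
  simpa [Function.mem_support] using this

/-- The reflected shifted bump has unit integral. [folklore] -/
theorem integral_normed_comp_sub (φ : ContDiffBump (0 : ℝ)) (t' : ℝ) :
    ∫ s, φ.normed volume (t' - s) = 1 := by
  rw [integral_sub_left_eq_self (fun s => φ.normed volume s) volume t']
  exact φ.integral_normed

/-- The primitive `P(s) = ∫_t^s ρ` of the reflected shifted bump has derivative `ρ`. [folklore] -/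
theorem hasDerivAt_primitive_normed (φ : ContDiffBump (0 : ℝ)) (t t' s : ℝ) :
    HasDerivAt (fun u => ∫ x in t..u, φ.normed volume (t' - x)) (φ.normed volume (t' - s)) s :=
  ((contDiff_normed_comp_sub φ t').continuous.integral_hasStrictDerivAt t s).hasDerivAt

/-- The primitive of the reflected shifted bump is smooth. [folklore] -/
theorem contDiff_primitive_normed (φ : ContDiffBump (0 : ℝ)) (t t' : ℝ) :
    ContDiff ℝ ∞ fun u => ∫ x in t..u, φ.normed volume (t' - x) := by
  rw [contDiff_infty_iff_deriv]
  refine ⟨fun s => (hasDerivAt_primitive_normed φ t t' s).differentiableAt, ?_⟩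
  have : deriv (fun u => ∫ x in t..u, φ.normed volume (t' - x)) =
      fun s => φ.normed volume (t' - s) := by
    ext s
    exact (hasDerivAt_primitive_normed φ t t' s).deriv
  rw [this]
  exact contDiff_normed_comp_sub φ t'

/-- Below `t` the primitive vanishes when the bump lives to the right of `t`
(`t' - rOut ≥ t`). [folklore] -/
theorem primitive_normed_eq_zero (φ : ContDiffBump (0 : ℝ)) {t t' s : ℝ} (ht' : t ≤ t' - φ.rOut)
    (hs : s ≤ t) : ∫ x in t..s, φ.normed volume (t' - x) = 0 := by
  rw [integral_symm, neg_eq_zero]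
  refine intervalIntegral.integral_zero_ae (Eventually.of_forall fun x hx => ?_)
  rw [uIoc_of_le hs] at hx
  obtain ⟨-, hx2⟩ := hx
  have hr := φ.rOut_pos
  refine normed_comp_sub_eq_zero φ ?_
  rw [abs_of_nonneg (by linarith)]
  linarith

/-- Above `t' + rOut` the primitive equals `1` (the whole mass has been collected), when the bump
lives to the right of `t`. [folklore] -/
theorem primitive_normed_eq_one (φ : ContDiffBump (0 : ℝ)) {t t' s : ℝ} (ht' : t ≤ t' - φ.rOut)
    (hs : t' + φ.rOut ≤ s) : ∫ x in t..s, φ.normed volume (t' - x) = 1 := by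
  rw [integral_eq_integral_of_support_subset, integral_normed_comp_sub]
  intro x hx
  rw [Function.mem_support] at hx
  by_contra hx'
  refine hx (normed_comp_sub_eq_zero φ ?_)
  simp only [mem_Ioc, not_and_or, not_lt, not_le] at hx'
  rcases hx' with h | h
  · rw [abs_of_nonneg (by linarith [φ.rOut_pos])]; linarith
  · rw [abs_of_nonpos (by linarith [φ.rOut_pos])]; linarith

/-- The primitive takes values in `[0, 1]`. [folklore] -/
theorem primitive_normed_mem_Icc (φ : ContDiffBump (0 : ℝ)) {t t' : ℝ} (ht' : t ≤ t' - φ.rOut)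
    (s : ℝ) : (∫ x in t..s, φ.normed volume (t' - x)) ∈ Icc (0 : ℝ) 1 := by
  rcases le_or_gt s t with hs | hs
  · rw [primitive_normed_eq_zero φ ht' hs]; exact ⟨le_rfl, zero_le_one⟩
  have hnn : ∀ x, 0 ≤ φ.normed volume (t' - x) := fun x => φ.nonneg_normed _
  refine ⟨intervalIntegral.integral_nonneg hs.le fun x _ => hnn x, ?_⟩
  rw [integral_of_le hs.le, ← integral_normed_comp_sub φ t']
  have hint : Integrable (fun x => φ.normed volume (t' - x)) volume := by
    have := φ.integrable_normed (μ := volume)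
    exact this.comp_sub_left t'
  exact setIntegral_le_integral hint (Eventually.of_forall hnn)

end Cutoff

/-! ### The lemma -/

/-- **du Bois-Reymond lemma with initial datum.** Let `U, F : ℝ → ℝ` be integrable on `(0, T)`,
`U` continuous on `(0, T)`, `c ∈ ℝ`, and assume that for every smooth compactly supported
`η : ℝ → ℝ` with `tsupport η ⊆ (-∞, T)`,
`∫_{s ∈ (0,T)} (η'(s) U(s) + η(s) F(s)) + η(0) c = 0`.
Then `U(t) = c + ∫_{s ∈ (0,t]} F(s)` for every `t ∈ (0, T)` (Serrin 1963, §3; Galdi 2000,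
Lemma 2.1; cf. Brezis 2011, Thm. 8.2). Proof: test with `η_ε(s) = B(s)(1 - ∫_t^s ρ_ε)` for a
normalised bump `ρ_ε` supported in `(t, t + ε)` and a bump `B ≡ 1` on `[-1, T+1]`; then
`η_ε(0) = 1`, `η_ε' = -ρ_ε` on `(0,T)`, and the identity says `(ρ_ε ⋆ U)(t + ε/2) = c + ∫ η_ε F`;
let `ε → 0` using the continuity of `U` at `t` on the left and dominated convergence
(`η_ε → 𝟙_{(-∞, t]}`, `|η_ε| ≤ 1`) on the right. [folklore] -/
theorem eq_add_setIntegral_of_forall_test {T c : ℝ} {U F : ℝ → ℝ}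
    (hU : IntegrableOn U (Ioo 0 T)) (hF : IntegrableOn F (Ioo 0 T))
    (hUc : ContinuousOn U (Ioo 0 T))
    (h : ∀ η : ℝ → ℝ, ContDiff ℝ ∞ η → HasCompactSupport η → tsupport η ⊆ Iio T →
      (∫ s in Ioo 0 T, (deriv η s * U s + η s * F s)) + η 0 * c = 0)
    {t : ℝ} (ht : t ∈ Ioo 0 T) : U t = c + ∫ s in Ioc 0 t, F s := by
  obtain ⟨ht0, htT⟩ := ht
  have hT : 0 < T := ht0.trans htT
  -- the fixed bump `B ≡ 1` on `[-1, T + 1]`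
  let B : ContDiffBump (T / 2 : ℝ) := ⟨T / 2 + 1, T / 2 + 2, by linarith, by linarith⟩
  have hBr : B.rIn = T / 2 + 1 := rfl
  have hB1 : ∀ s ∈ Icc (-1 : ℝ) (T + 1), (B : ℝ → ℝ) s = 1 := fun s hs =>
    B.one_of_mem_closedBall (by
      rw [mem_closedBall, Real.dist_eq, hBr, abs_le]; constructor <;> linarith [hs.1, hs.2])
  have hB1' : ∀ s ∈ Ioo (-1 : ℝ) (T + 1), (B : ℝ → ℝ) =ᶠ[𝓝 s] fun _ => 1 := fun s hs => by
    filter_upwards [Ioo_mem_nhds hs.1 hs.2] with x hx using hB1 x (Ioo_subset_Icc_self hx)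
  -- the shrinking bumps `ρₙ` supported in `(t, t + εₙ)`
  set δ : ℝ := (T - t) / 2 with hδ
  have hδpos : 0 < δ := by rw [hδ]; linarith
  set ε : ℕ → ℝ := fun n => δ / ((n : ℝ) + 1) with hε
  have hεpos : ∀ n, 0 < ε n := fun n => by positivity
  have hεle : ∀ n, ε n ≤ δ := fun n => by
    rw [hε]; exact div_le_self hδpos.le (by linarith [n.cast_nonneg (α := ℝ)])
  have hεlim : Tendsto ε atTop (𝓝 0) := by
    have := tendsto_one_div_add_atTop_nhds_zero_nat.const_mul δ
    rw [mul_zero] at this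
    simp only [hε]
    refine this.congr fun n => ?_
    rw [mul_one_div]
  let φ : ℕ → ContDiffBump (0 : ℝ) := fun n =>
    ⟨ε n / 4, ε n / 2, by linarith [hεpos n], by linarith [hεpos n]⟩
  have hφout : ∀ n, (φ n).rOut = ε n / 2 := fun n => rfl
  set tc : ℕ → ℝ := fun n => t + ε n / 2 with htc
  have htc_lim : Tendsto tc atTop (𝓝 t) := by
    have := (hεlim.div_const 2).const_add t
    simpa [htc] using this
  have hleft : ∀ n, t ≤ tc n - (φ n).rOut := fun n => by simp [htc, hφout]
  set ρ : ℕ → ℝ → ℝ := fun n s => (φ n).normed volume (tc n - s) with hρ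
  set P : ℕ → ℝ → ℝ := fun n s => ∫ x in t..s, (φ n).normed volume (tc n - x) with hP
  set η : ℕ → ℝ → ℝ := fun n s => B s * (1 - P n s) with hη
  -- properties of `ηₙ`
  have hη_smooth : ∀ n, ContDiff ℝ ∞ (η n) := fun n =>
    B.contDiff.mul (contDiff_const.sub (contDiff_primitive_normed (φ n) t (tc n)))
  have hη_supp : ∀ n, HasCompactSupport (η n) := fun n => B.hasCompactSupport.mul_right
  have hη_zero : ∀ n s, tc n + (φ n).rOut ≤ s → η n s = 0 := fun n s hs => by
    simp only [hη, hP, primitive_normed_eq_one (φ n) (hleft n) hs, sub_self, mul_zero]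
  have hη_top : ∀ n, tc n + (φ n).rOut < T := fun n => by
    simp only [htc, hφout]; linarith [hεle n]
  have hη_tsupp : ∀ n, tsupport (η n) ⊆ Iio T := fun n => by
    refine (closure_minimal (fun s hs => ?_) isClosed_Iic).trans (Iic_subset_Iio.2 (hη_top n))
    by_contra hs'
    exact hs (hη_zero n s (not_le.1 hs').le)
  have hη0 : ∀ n, η n 0 = 1 := fun n => by
    simp only [hη, hP, hB1 0 ⟨by norm_num, by linarith⟩,
      primitive_normed_eq_zero (φ n) (hleft n) ht0.le, sub_zero, mul_one]
  have hη_eq : ∀ n, ∀ s ∈ Ioo 0 T, η n s = 1 - P n s := fun n s hs => by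
    simp only [hη, hB1 s ⟨by linarith [hs.1], by linarith [hs.2]⟩, one_mul]
  have hη_deriv : ∀ n, ∀ s ∈ Ioo 0 T, deriv (η n) s = -ρ n s := fun n s hs => by
    have h1 : η n =ᶠ[𝓝 s] fun x => 1 - P n x := by
      filter_upwards [hB1' s ⟨by linarith [hs.1], by linarith [hs.2]⟩] with x hx
      simp only [hη, hx, one_mul]
    rw [h1.deriv_eq]
    exact ((hasDerivAt_primitive_normed (φ n) t (tc n) s).const_sub 1).deriv
  have hη_bound : ∀ n, ∀ s ∈ Ioo 0 T, |η n s| ≤ 1 := fun n s hs => by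
    rw [hη_eq n s hs]
    have := primitive_normed_mem_Icc (φ n) (hleft n) s
    rw [abs_le]; constructor <;> linarith [this.1, this.2]
  -- the extension of `U` by zero and its continuity at `t`
  set Ut : ℝ → ℝ := (Ioo 0 T).indicator U with hUt
  have hUt_int : Integrable Ut volume := hU.integrable_indicator measurableSet_Ioo
  have hUt_t : Ut t = U t := by simp [hUt, indicator_of_mem (show t ∈ Ioo 0 T from ⟨ht0, htT⟩)]
  have hUt_cont : Tendsto Ut (𝓝 t) (𝓝 (Ut t)) := by
    have hmem : Ioo 0 T ∈ 𝓝 t := Ioo_mem_nhds ht0 htT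
    have h1 : Ut =ᶠ[𝓝 t] U := by
      filter_upwards [hmem] with x hx using indicator_of_mem hx _
    rw [hUt_t]
    exact ((hUc.continuousAt hmem).tendsto).congr' h1.symm
  -- the identity for each `n`: `-(ρₙ ⋆ U)(tcₙ) + ∫ ηₙ F + c = 0`
  have hρ_cont : ∀ n, Continuous (ρ n) := fun n => (contDiff_normed_comp_sub (φ n) (tc n)).continuous
  have hρ_bdd : ∀ n, ∃ C, ∀ s, ‖ρ n s‖ ≤ C := fun n => by
    obtain ⟨C, hC⟩ := ((φ n).continuous_normed (μ := volume)).bounded_above_of_compact_support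
      (φ n).hasCompactSupport_normed
    exact ⟨C, fun s => hC _⟩
  have hconv_eq : ∀ n, ∫ s in Ioo 0 T, ρ n s * U s =
      ((φ n).normed volume ⋆[lsmul ℝ ℝ, volume] Ut) (tc n) := fun n => by
    rw [convolution_eq_swap, ← MeasureTheory.integral_indicator measurableSet_Ioo]
    congr 1
    ext s
    simp only [hUt, lsmul_apply, smul_eq_mul, hρ]
    by_cases hs : s ∈ Ioo 0 T
    · simp [indicator_of_mem hs]
    · simp [indicator_of_notMem hs]
  have hid : ∀ n, -((φ n).normed volume ⋆[lsmul ℝ ℝ, volume] Ut) (tc n) +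
      (∫ s in Ioo 0 T, η n s * F s) + c = 0 := fun n => by
    have h0 := h (η n) (hη_smooth n) (hη_supp n) (hη_tsupp n)
    rw [hη0 n, one_mul] at h0
    have hi1 : IntegrableOn (fun s => ρ n s * U s) (Ioo 0 T) := by
      obtain ⟨C, hC⟩ := hρ_bdd n
      exact hU.bdd_mul (hρ_cont n).aestronglyMeasurable (Eventually.of_forall hC)
    have hi2 : IntegrableOn (fun s => η n s * F s) (Ioo 0 T) := by
      refine hF.bdd_mul (hη_smooth n).continuous.aestronglyMeasurable (c := 1) ?_
      exact (ae_restrict_iff' measurableSet_Ioo).2 (Eventually.of_forall fun s hs => by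
        simpa [Real.norm_eq_abs] using hη_bound n s hs)
    have hcongr : ∫ s in Ioo 0 T, (deriv (η n) s * U s + η n s * F s) =
        ∫ s in Ioo 0 T, (-(ρ n s * U s) + η n s * F s) := by
      refine setIntegral_congr_fun measurableSet_Ioo fun s hs => ?_
      simp only [hη_deriv n s hs, neg_mul]
    have hi1' : IntegrableOn (fun s => -(ρ n s * U s)) (Ioo 0 T) := hi1.neg
    rw [hcongr, integral_add hi1' hi2, MeasureTheory.integral_neg, hconv_eq n] at h0
    linarith
  -- limits of the two variable terms
  have hlim1 : Tendsto (fun n => ((φ n).normed volume ⋆[lsmul ℝ ℝ, volume] Ut) (tc n)) atTop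
      (𝓝 (U t)) := by
    rw [← hUt_t]
    refine ContDiffBump.convolution_tendsto_right (φ := φ) (g := fun _ => Ut) ?_
      (Eventually.of_forall fun _ => hUt_int.aestronglyMeasurable) ?_ htc_lim
    · simpa [hφout] using hεlim.div_const 2
    · exact hUt_cont.comp tendsto_snd
  have hlim2 : Tendsto (fun n => ∫ s in Ioo 0 T, η n s * F s) atTop
      (𝓝 (∫ s in Ioo 0 T, (Iic t).indicator (fun _ => (1 : ℝ)) s * F s)) := by
    refine tendsto_integral_of_dominated_convergence (fun s => ‖F s‖)
      (fun n => ((hη_smooth n).continuous.aestronglyMeasurable.mul hF.aestronglyMeasurable))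
      hF.norm ?_ ?_
    · intro n
      refine (ae_restrict_iff' measurableSet_Ioo).2 (Eventually.of_forall fun s hs => ?_)
      rw [norm_mul]
      calc ‖η n s‖ * ‖F s‖ ≤ 1 * ‖F s‖ := by
            gcongr; simpa [Real.norm_eq_abs] using hη_bound n s hs
        _ = ‖F s‖ := one_mul _
    · refine (ae_restrict_iff' measurableSet_Ioo).2 (Eventually.of_forall fun s hs => ?_)
      refine Tendsto.mul_const _ ?_
      rcases le_or_gt s t with hst | hst
      · have : ∀ n, η n s = 1 := fun n => by
          rw [hη_eq n s hs, hP]; simp [primitive_normed_eq_zero (φ n) (hleft n) hst]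
        simp only [this, indicator_of_mem (show s ∈ Iic t from hst)]
        exact tendsto_const_nhds
      · have hev : ∀ᶠ n in atTop, η n s = 0 := by
          have : ∀ᶠ n in atTop, ε n < s - t := (tendsto_order.1 hεlim).2 _ (by linarith)
          filter_upwards [this] with n hn
          refine hη_zero n s ?_
          simp only [htc, hφout]; linarith
        simp only [indicator_of_notMem (show s ∉ Iic t from not_le.2 hst)]
        exact tendsto_const_nhds.congr' (by filter_upwards [hev] with n hn; rw [hn])
  have hind : ∫ s in Ioo 0 T, (Iic t).indicator (fun _ => (1 : ℝ)) s * F s =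
      ∫ s in Ioc 0 t, F s := by
    have : (fun s => (Iic t).indicator (fun _ => (1 : ℝ)) s * F s) = (Iic t).indicator F := by
      ext s; by_cases hs : s ∈ Iic t <;> simp [hs]
    have hset : Ioo 0 T ∩ Iic t = Ioc 0 t := by
      ext s
      simp only [mem_inter_iff, mem_Ioo, mem_Iic, mem_Ioc]
      constructor
      · rintro ⟨⟨h1, -⟩, h3⟩; exact ⟨h1, h3⟩
      · rintro ⟨h1, h2⟩; exact ⟨⟨h1, lt_of_le_of_lt h2 htT⟩, h2⟩
    rw [this, setIntegral_indicator measurableSet_Iic, hset]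
  -- conclusion
  have hlim : Tendsto (fun n => -((φ n).normed volume ⋆[lsmul ℝ ℝ, volume] Ut) (tc n) +
      (∫ s in Ioo 0 T, η n s * F s) + c) atTop (𝓝 (-U t + (∫ s in Ioc 0 t, F s) + c)) := by
    rw [← hind]
    exact (hlim1.neg.add hlim2).add tendsto_const_nhds
  have h0 : (-U t + (∫ s in Ioc 0 t, F s) + c) = 0 :=
    tendsto_nhds_unique hlim (by simpa only [hid] using tendsto_const_nhds)
  linarith

end Literature.Analysis.FunctionSpaces
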